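import Mathlib
import HarnessLib
import HarnessLib.Audit
import Summits.ABC.ABC.Theses.IneffectiveSubspace
import Summits.ABC.ABC.Theorems.TowerFourSubLiouville.Negative.Framing
import Summits.ABC.ABC.Theorems.TowerFourSubLiouville.Negative.DialCalibration
import Literature.NumberTheory.DiophantineGeometry.AbcWave0
import Literature.NumberTheory.DiophantineGeometry.AbcWave0RothProofs

/-!
# Line `fourth-radical-binomial-thue` — crux `IneffectiveSubspace.TowerFourSubLiouville` (stmt-ABC-1649) — skeleton v1

Planner `planner-cruxplan-stmt-ABC-1649-fourth-radical-binom-0` (crux-plan, round 1, 2026-08-16), from the idea card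
`Ideas/fourth-radical-binomial-thue.md` (TRIAGE-r1-1/2/3: pass ×3; merged in spirit with `defect-radical-subliouville`:
same lever, one normal form).

THE CRUX. `TowerFourSubLiouville`: `∃ A < 2, TowerIneq(4, A)` — beat the Liouville-trivial exponent `2` of the level-4
Vojta tower inequality `c < C(ε)·(∏ xᵢyᵢzᵢ)^(A+ε)` on positive coprime solutions of `x₀x₁²x₂³x₃⁴ + y₀y₁²y₂³y₃⁴ = z₀z₁²z₂³z₃⁴`.

THE LINE. The least `∏ xᵢ` over level-4 representations of `m` is the fourth-power radical `S₄(m) = ∏ p^⌈v_p(m)/4⌉`, and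
a point that is bad for an exponent `s = 2 − δ` has (disprover's `Negative.Framing.bad_point_shape`, from the identity
`Π⁴ = abc·E`, `E = (x₀y₀z₀)³(x₁y₁z₁)²(x₂y₂z₂)`) `min(a,b)·E ≤ 2C^(−4/s)·c^(2δ/(2−δ))`: it is a coprime solution of the
DIAGONAL QUARTIC THUE INEQUALITY `|wZ⁴ − vY⁴| = min(a,b)` with `max(min(a,b), v, w) ≤ Z^(O(δ))`.  So the crux is
EQUIVALENT to a uniform power saving over Liouville's `|wZ⁴ − vY⁴| ≥ 1` for the binomial quartic family, polynomially
uniform in the coefficients (`UBQ η` below, the card's C⁺ = `UniformBinomialQuartic η`, for SOME `η > 0`).  The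
skeleton PEELS that statement:

* `stub_transfer` [TRANSFER, provable now, size M]: `(∃ η > 0, UBQ η) → TowerFourSubLiouville` — the `S₄`/bad-point
  bookkeeping (`A = 2 − η/20`; import `bad_point_shape`, do not re-derive it).
* `stub_fixedFormsRoth` [STRATUM R, provable now from the in-tree PROVED `roth_holds`, size M–L]: for every finite box
  `max(v,w) ≤ H` and every `0 < η < 2` the saving holds beyond some `Z₀(H, η)` — Thue–Siegel–Roth per form
  (`θ = (w/v)^(1/4)`: `|wZ⁴ − vY⁴| = vZ⁴|θ⁴ − (Y/Z)⁴| ≥ vθ³Z⁴·|θ − Y/Z| ≫ Z^(2−ε')`; the rational-`θ` forms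
  `(q⁴, p⁴)` factor: `|(pZ)⁴ − (qY)⁴| ≥ (pZ)³`).
* `stub_genericFormsSaving` [CORE, OPEN-HARD — the crux in Thue coordinates minus the Roth stratum]: for SOME `η > 0` and
  SOME finite exceptional box `H`, the saving holds for all FOURTH-POWER-FREE coefficient pairs with `max(v,w) > H`.
* `TowerFourSubLiouville_of` (kernel-checked, concludes the crux BY NAME): shrink `η ↦ min η 1`, reduce an arbitrary
  coefficient pair to its fourth-power-free parts `v = v₀s⁴, w = w₀t⁴` (`(v₀, w₀, sY, tZ)` is again admissible and has
  the same value `wZ⁴ − vY⁴`), split on `max(v₀,w₀) ≤ H` (stratum R) / `> H` (core), feed `UBQ (min η 1)` to the transfer.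

`sorry` occurs ONLY in the three `stub_*` theorems.  Everything else (`quarticSaving_mono`, `exists_eq_mul_pow_four`,
`quarticSaving_of_reduced`, `ubq_of_on_off`, `TowerFourSubLiouville_of`, and the Stub-3 waypoint `quarticSaving_of_squares`:
reducible pairs `v = s², w = t²` have every saving `η ≤ 2`) is proved.

HONEST LABEL (card + all three triagers + Disproof.lean "Why it resists §1"): modulo `stub_fixedFormsRoth` (a theorem) the
core stub is crux-EQUIVALENT (`CruxGivesUBQ` below is the converse, typed, not a stub).  The line is a MAP: it lands the
normal form and the Roth stratum and isolates the residual as one sharply typed statement — the first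
polynomial-in-the-coefficients size bound for an infinite family of quartic Thue inequalities (Hall-type "some θ > 0",
cf. `Literature.Barriers.ABC.HallExponentSharp`).  No mechanism for the core is claimed.

Disproof.lean used (refuter-cdisprove-stmt-ABC-1649-0; landed `Negative.Framing`, `Negative.DialCalibration`, both imported
here so every stub is checked against them): `crux_of_abc`/`towerFourSubLiouville_of_abc` — honoured: `ABC ⟹ UBQ η` for
every `η < 8/13` (rad ≤ avw·YZ ≤ Z^(2+13η/4) against `c ≥ Z⁴`), so no stub is refutable short of `¬ABC`;
`towerFourSubLiouville_false_without_pos` / `_false_without_eq` — honoured at `stub_transfer` (the tower side keeps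
positivity and the equation verbatim) and inside `QuarticSaving` (`0 < v, w, Y`, the value `wZ⁴ − vY⁴` itself is
bounded, `Z = 0` is vacuous); coprimality (`towerIneq4NoCoprime_*`: not load-bearing under ABC, floor 4/3 without it) —
kept as `Nat.Coprime (vY) (wZ)` because stratum R and the reduction use it; floors `towerIneq4_false_below_one`,
`not_towerIneq4OneNoEps`, `not_towerIneq4_constant_one_exponent_13_10` — respected: the transfer yields `A = 2 − η/20`
with `ε`, `C(ε)` and an ineffective `Z₀`, never `A ≤ 1`, never constant `1`.  `-- Targets`: none registered (no line
picked before this one); no stub instantiates a refuted strengthening; `ledger negatives --problem ABC` (stmt-ABC-1689,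
stmt-ABC-1205) unrelated.
-/

set_option linter.dupNamespace false

namespace Summit.ABC.ABC.Cruxes.TowerFourSubLiouville.FourthRadicalBinomialThue

open scoped BigOperators
open Summit.ABC.ABC.Theses.IneffectiveSubspace

/-! ## The statements of the line (named `Prop`s) -/

/-- **The saving inequality for one quadruple** `(v, w, Y, Z)` with saving `η`: if `v, w, Y > 0`,
`gcd(vY, wZ) = 1`, `max(v,w) ≤ Z^η` and `wZ⁴ ≠ vY⁴`, then `|wZ⁴ − vY⁴| > Z^η` (difference taken in `ℝ`).
Liouville gives `≥ 1`; abc gives this for every `η < 8/13`; the heuristic critical value is `η* = 1`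
(card) resp. `2/3` (Disproof.lean §2). -/
def QuarticSaving (η : ℝ) (v w Y Z : ℕ) : Prop :=
  0 < v → 0 < w → 0 < Y → Nat.Coprime (v * Y) (w * Z) → ((max v w : ℕ) : ℝ) ≤ (Z : ℝ) ^ η →
    w * Z ^ 4 ≠ v * Y ^ 4 → (Z : ℝ) ^ η < |((w * Z ^ 4 : ℕ) : ℝ) - ((v * Y ^ 4 : ℕ) : ℝ)|

/-- **C⁺ = `UBQ η`** (the card's `UniformBinomialQuartic η`): the saving `η` holds for ALL coefficient pairs
beyond one height `Z₀`. The crux is equivalent to `∃ η > 0, UBQ η` (`stub_transfer` + `CruxGivesUBQ`). -/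
def UBQ (η : ℝ) : Prop :=
  ∃ Z₀ : ℕ, ∀ v w Y Z : ℕ, Z₀ ≤ Z → QuarticSaving η v w Y Z

/-- `m` is fourth-power-free: no `t⁴ ∣ m` with `t ≠ 1`. -/
def FourthPowerFree (m : ℕ) : Prop :=
  ∀ t : ℕ, t ^ 4 ∣ m → t = 1

/-- **Stratum R** (finitely many forms): the saving `η` on the box `max(v,w) ≤ H`, beyond some `Z₀(H, η)`. -/
def UBQOn (H : ℕ) (η : ℝ) : Prop :=
  ∃ Z₀ : ℕ, ∀ v w Y Z : ℕ, Z₀ ≤ Z → max v w ≤ H → QuarticSaving η v w Y Z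

/-- **The generic family**: the saving `η` for fourth-power-free coefficient pairs OFF the box `max(v,w) ≤ H`. -/
def UBQOff (H : ℕ) (η : ℝ) : Prop :=
  ∃ Z₀ : ℕ, ∀ v w Y Z : ℕ, Z₀ ≤ Z → H < max v w → FourthPowerFree v → FourthPowerFree w →
    QuarticSaving η v w Y Z

/-- **Stub 1 · `Transfer`** (C⁺ ⟹ crux; the card's `CruxOfUBQ`; provable now): some positive saving gives the
crux, with `A = 2 − η/20`. Proof sketch: for `s = A + ε < 2` a point with `C·Π^s ≤ c` has, by
`Negative.Framing.bad_point_shape`, `min(a,b)·E ≤ 2C^(−4/s) c^(δ')`, `δ' = 2(2−s)/s`; with (say) `a ≤ b`,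
`b = vY⁴`, `c = wZ⁴` (`v = y₀y₁²y₂³ ≤ E_y³`, `w ≤ E_z³`, `Y = y₃`, `Z = z₃`) one gets `max(a,v,w) ≤ 8c^(3δ')`,
`c ≤ (8Z⁴)^(1/(1−3δ'))`, hence `max(a,v,w) ≤ Z^η` and `a < Z^η`-contradiction for `Z ≥ Z₁`; points with `Z < Z₁`
have bounded `c` and are absorbed by `C`; for `s ≥ 2` use `c ≤ √2·Π²`. -/
def Transfer : Prop :=
  (∃ η : ℝ, 0 < η ∧ UBQ η) → TowerFourSubLiouville

/-- **Stub 2 · `FixedFormsRoth`** (stratum R; provable now from `Literature.NumberTheory.DiophantineGeometry.roth_holds`):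
every finite box of forms has every saving `η < 2`. -/
def FixedFormsRoth : Prop :=
  ∀ H : ℕ, ∀ η : ℝ, 0 < η → η < 2 → UBQOn H η

/-- **Stub 3 · `GenericFormsSaving`** (the CORE; OPEN-HARD; crux-equivalent modulo Stub 2): some saving `η > 0`
for all fourth-power-free coefficient pairs off some finite box. -/
def GenericFormsSaving : Prop :=
  ∃ η : ℝ, 0 < η ∧ ∃ H : ℕ, UBQOff H η

/-- The converse of the transfer (NOT a stub; certifies that C⁺ is an equivalent, not a strengthening in
costume; provable now: an enemy `wZ⁴ − vY⁴ = a` with `max(|a|,v,w) ≤ Z^η` is the tower point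
`x = (|a|,1,1,1)`, `y = (v,1,1,Y)`, `z = (w,1,1,Z)` (or its mirror) with `c ≥ Z⁴` and `Π = |a|vw·YZ ≤ 2Z^(2+13η/4)`,
violating `TowerIneq(4, A)` once `(A + ε)(2 + 13η/4) < 4`). File with `--supports stmt-ABC-1649` if wanted. -/
def CruxGivesUBQ : Prop :=
  TowerFourSubLiouville → ∃ η : ℝ, 0 < η ∧ UBQ η

/-- Calibration (NOT a stub; provable now from `ABC_iff`): abc gives every saving `η < 8/13`
(`rad(a·vY⁴·wZ⁴) ≤ a·v·w·Y·Z ≤ 2Z^(2+13η/4)` against `c = wZ⁴ ≥ Z⁴`). Consistent with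
`Negative.Framing.towerFourSubLiouville_of_abc`: no stub of this line is refutable short of `¬ABC`. -/
def AbcGivesUBQ : Prop :=
  _root_.ABC → ∀ η : ℝ, 0 < η → η < 8 / 13 → UBQ η

/-! ## Registered stubs — `sorry` lives ONLY in these three theorems (statements fully unfolded) -/

/-- Stub 1, registered form (= def `Transfer`, unfolded). TRANSFER C⁺ ⟹ crux; provable now (size M). -/
theorem stub_transfer : (∃ η : ℝ, 0 < η ∧ ∃ Z₀ : ℕ, ∀ v w Y Z : ℕ, Z₀ ≤ Z → 0 < v → 0 < w → 0 < Y → Nat.Coprime (v * Y) (w * Z) → ((max v w : ℕ) : ℝ) ≤ (Z : ℝ) ^ η → w * Z ^ 4 ≠ v * Y ^ 4 → (Z : ℝ) ^ η < |((w * Z ^ 4 : ℕ) : ℝ) - ((v * Y ^ 4 : ℕ) : ℝ)|) → Summit.ABC.ABC.Theses.IneffectiveSubspace.TowerFourSubLiouville := by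
  sorry

/-- Stub 2, registered form (= def `FixedFormsRoth`, unfolded). STRATUM R; provable now from `roth_holds` (size M–L). -/
theorem stub_fixedFormsRoth : ∀ H : ℕ, ∀ η : ℝ, 0 < η → η < 2 → ∃ Z₀ : ℕ, ∀ v w Y Z : ℕ, Z₀ ≤ Z → max v w ≤ H → 0 < v → 0 < w → 0 < Y → Nat.Coprime (v * Y) (w * Z) → ((max v w : ℕ) : ℝ) ≤ (Z : ℝ) ^ η → w * Z ^ 4 ≠ v * Y ^ 4 → (Z : ℝ) ^ η < |((w * Z ^ 4 : ℕ) : ℝ) - ((v * Y ^ 4 : ℕ) : ℝ)| := by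
  sorry

/-- Stub 3, registered form (= def `GenericFormsSaving`, unfolded). CORE; OPEN-HARD (crux-equivalent modulo Stub 2). -/
theorem stub_genericFormsSaving : ∃ η : ℝ, 0 < η ∧ ∃ H Z₀ : ℕ, ∀ v w Y Z : ℕ, Z₀ ≤ Z → H < max v w → (∀ t : ℕ, t ^ 4 ∣ v → t = 1) → (∀ t : ℕ, t ^ 4 ∣ w → t = 1) → 0 < v → 0 < w → 0 < Y → Nat.Coprime (v * Y) (w * Z) → ((max v w : ℕ) : ℝ) ≤ (Z : ℝ) ^ η → w * Z ^ 4 ≠ v * Y ^ 4 → (Z : ℝ) ^ η < |((w * Z ^ 4 : ℕ) : ℝ) - ((v * Y ^ 4 : ℕ) : ℝ)| := by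
  sorry

/-! ### Consistency: each named statement IS its registered stub (definitional unfolding only) -/

theorem transfer_holds : Transfer := stub_transfer
theorem fixedFormsRoth_holds : FixedFormsRoth := stub_fixedFormsRoth
theorem genericFormsSaving_holds : GenericFormsSaving := stub_genericFormsSaving

/-! ### Name-keyed aliases of the three statements (hypotheses of the composition) -/
namespace Registered

/-- Alias of `Transfer` keyed by the registered stub name. -/
abbrev stub_transfer : Prop := Transfer
/-- Alias of `FixedFormsRoth` keyed by the registered stub name. -/
abbrev stub_fixedFormsRoth : Prop := FixedFormsRoth
/-- Alias of `GenericFormsSaving` keyed by the registered stub name. -/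
abbrev stub_genericFormsSaving : Prop := GenericFormsSaving

end Registered

/-! ## Proved glue (no `sorry` below this line) -/

/-- Monotonicity of the saving in `η` (for `Z ≥ 1`): a larger saving implies a smaller one. -/
theorem quarticSaving_mono {η η' : ℝ} (hle : η' ≤ η) {v w Y Z : ℕ} (hZ : 1 ≤ Z)
    (h : QuarticSaving η v w Y Z) : QuarticSaving η' v w Y Z := by
  intro hv hw hY hcop hmax hne
  have hZ1 : (1 : ℝ) ≤ (Z : ℝ) := by exact_mod_cast hZ
  have hmono : (Z : ℝ) ^ η' ≤ (Z : ℝ) ^ η := Real.rpow_le_rpow_of_exponent_le hZ1 hle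
  exact lt_of_le_of_lt hmono (h hv hw hY hcop (hmax.trans hmono) hne)

/-- Fourth-power-free decomposition: every `m > 0` is `m₀·s⁴` with `m₀` fourth-power-free (`s` = the largest
`s` with `s⁴ ∣ m`). -/
theorem exists_eq_mul_pow_four {m : ℕ} (hm : 0 < m) :
    ∃ m₀ s : ℕ, 0 < m₀ ∧ 0 < s ∧ m = m₀ * s ^ 4 ∧ FourthPowerFree m₀ := by
  classical
  have hb : ∀ s : ℕ, s ^ 4 ∣ m → s ≤ m := by
    intro s hs
    rcases Nat.eq_zero_or_pos s with h0 | hs0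
    · exfalso
      rw [h0, zero_pow (by norm_num)] at hs
      exact absurd (eq_zero_of_zero_dvd hs) hm.ne'
    · exact le_trans (Nat.le_self_pow (by norm_num) s) (Nat.le_of_dvd hm hs)
  have h1 : (1 : ℕ) ^ 4 ∣ m := by simp
  have hs4 : (Nat.findGreatest (fun s => s ^ 4 ∣ m) m) ^ 4 ∣ m :=
    Nat.findGreatest_spec (P := fun s => s ^ 4 ∣ m) hm h1
  have hs1 : 1 ≤ Nat.findGreatest (fun s => s ^ 4 ∣ m) m :=
    Nat.le_findGreatest (P := fun s => s ^ 4 ∣ m) hm h1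
  have key : ∀ t : ℕ, t ^ 4 ∣ m → t ≤ Nat.findGreatest (fun s => s ^ 4 ∣ m) m :=
    fun t ht => Nat.le_findGreatest (P := fun s => s ^ 4 ∣ m) (hb t ht) ht
  generalize hS : Nat.findGreatest (fun s => s ^ 4 ∣ m) m = s at hs4 hs1 key
  obtain ⟨m₀, hm₀⟩ := hs4
  have hm₀pos : 0 < m₀ := by
    rcases Nat.eq_zero_or_pos m₀ with h0 | h0
    · rw [h0, mul_zero] at hm₀; omega
    · exact h0
  refine ⟨m₀, s, hm₀pos, hs1, by rw [hm₀]; ring, ?_⟩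
  intro t ht
  have ht0 : 0 < t := by
    rcases Nat.eq_zero_or_pos t with h0 | h0
    · exfalso
      rw [h0, zero_pow (by norm_num)] at ht
      exact absurd (eq_zero_of_zero_dvd ht) hm₀pos.ne'
    · exact h0
  have hst : (s * t) ^ 4 ∣ m := by
    rw [hm₀, mul_pow]
    exact mul_dvd_mul_left _ ht
  have hle : s * t ≤ s * 1 := by
    rw [mul_one]
    exact key _ hst
  have ht1 : t ≤ 1 := le_of_mul_le_mul_left hle hs1
  omega

/-- A saving for the REDUCED quadruple `(v₀, w₀, sY, tZ)` is a saving for `(v, w, Y, Z)` when `v = v₀s⁴`,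
`w = w₀t⁴` (`η ≥ 0`): admissibility transfers down, the value `wZ⁴ − vY⁴` is unchanged, and `Z ≤ tZ`. -/
theorem quarticSaving_of_reduced {η : ℝ} (hη : 0 ≤ η) {v w Y Z v₀ w₀ s t : ℕ}
    (hs : 0 < s) (ht : 0 < t) (hv : v = v₀ * s ^ 4) (hw : w = w₀ * t ^ 4)
    (h : QuarticSaving η v₀ w₀ (s * Y) (t * Z)) : QuarticSaving η v w Y Z := by
  intro hv0 hw0 hY hcop hmax hne
  have hv₀ : 0 < v₀ := by
    rcases Nat.eq_zero_or_pos v₀ with h0 | h0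
    · rw [h0, zero_mul] at hv; omega
    · exact h0
  have hw₀ : 0 < w₀ := by
    rcases Nat.eq_zero_or_pos w₀ with h0 | h0
    · rw [h0, zero_mul] at hw; omega
    · exact h0
  have hsY : 0 < s * Y := Nat.mul_pos hs hY
  -- coprimality of the reduced pair
  have hdv : v₀ * (s * Y) ∣ v * Y := ⟨s ^ 3, by rw [hv]; ring⟩
  have hdw : w₀ * (t * Z) ∣ w * Z := ⟨t ^ 3, by rw [hw]; ring⟩
  have hcop' : Nat.Coprime (v₀ * (s * Y)) (w₀ * (t * Z)) :=
    Nat.Coprime.coprime_dvd_right hdw (Nat.Coprime.coprime_dvd_left hdv hcop)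
  -- the bases: `Z ≤ tZ`
  have hZle : ((Z : ℕ) : ℝ) ≤ ((t * Z : ℕ) : ℝ) := Nat.cast_le.mpr (Nat.le_mul_of_pos_left Z ht)
  have hZ0 : (0 : ℝ) ≤ (Z : ℝ) := Nat.cast_nonneg Z
  have hpow : (Z : ℝ) ^ η ≤ ((t * Z : ℕ) : ℝ) ^ η := Real.rpow_le_rpow hZ0 hZle hη
  -- `max v₀ w₀ ≤ max v w`
  have hv₀le : v₀ ≤ v := by
    rw [hv]; exact Nat.le_mul_of_pos_right v₀ (pow_pos hs 4)
  have hw₀le : w₀ ≤ w := by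
    rw [hw]; exact Nat.le_mul_of_pos_right w₀ (pow_pos ht 4)
  have hmax' : ((max v₀ w₀ : ℕ) : ℝ) ≤ ((t * Z : ℕ) : ℝ) ^ η := by
    have h1 : ((max v₀ w₀ : ℕ) : ℝ) ≤ ((max v w : ℕ) : ℝ) := Nat.cast_le.mpr (max_le_max hv₀le hw₀le)
    exact h1.trans (hmax.trans hpow)
  -- the two values agree
  have hwZ : w₀ * (t * Z) ^ 4 = w * Z ^ 4 := by rw [hw]; ring
  have hvY : v₀ * (s * Y) ^ 4 = v * Y ^ 4 := by rw [hv]; ring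
  have hne' : w₀ * (t * Z) ^ 4 ≠ v₀ * (s * Y) ^ 4 := by rwa [hwZ, hvY]
  have key := h hv₀ hw₀ hsY hcop' hmax' hne'
  rw [hwZ, hvY] at key
  exact lt_of_le_of_lt hpow key

/-- **Stratum R + generic family ⟹ the uniform inequality** (for `η ≥ 0`): reduce to fourth-power-free
coefficients and split on `max(v₀, w₀) ≤ H`. -/
theorem ubq_of_on_off {H : ℕ} {η : ℝ} (hη : 0 ≤ η) (hon : UBQOn H η) (hoff : UBQOff H η) : UBQ η := by
  obtain ⟨Z₁, h₁⟩ := hon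
  obtain ⟨Z₂, h₂⟩ := hoff
  refine ⟨max Z₁ Z₂, fun v w Y Z hZ => ?_⟩
  intro hv hw hY hcop hmax hne
  obtain ⟨v₀, s, _hv₀, hs, hvs, hvf⟩ := exists_eq_mul_pow_four hv
  obtain ⟨w₀, t, _hw₀, ht, hwt, hwf⟩ := exists_eq_mul_pow_four hw
  have hZ₁ : Z₁ ≤ t * Z := le_trans (le_trans (le_max_left _ _) hZ) (Nat.le_mul_of_pos_left Z ht)
  have hZ₂ : Z₂ ≤ t * Z := le_trans (le_trans (le_max_right _ _) hZ) (Nat.le_mul_of_pos_left Z ht)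
  have hred : QuarticSaving η v₀ w₀ (s * Y) (t * Z) := by
    rcases Nat.lt_or_ge H (max v₀ w₀) with hlt | hle
    · exact h₂ v₀ w₀ (s * Y) (t * Z) hZ₂ hlt hvf hwf
    · exact h₁ v₀ w₀ (s * Y) (t * Z) hZ₁ hle
  exact quarticSaving_of_reduced hη hs ht hvs hwt hred hv hw hY hcop hmax hne

/-- **Waypoint (a) inside Stub 3, proved: REDUCIBLE pairs are trivial.** If `v = s²` and `w = t²` then
`t²Z⁴ − s²Y⁴ = (tZ² − sY²)(tZ² + sY²)`, so a non-zero value has `|wZ⁴ − vY⁴| ≥ tZ² + sY² ≥ Z² + 1 > Z^η` for every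
`η ≤ 2` and `Z ≥ 1`. (So a Stub-3 prover may assume `¬(IsSquare v ∧ IsSquare w)`, i.e. that `wX⁴ − v` is irreducible
over `ℚ` for fourth-power-free coprime `v, w`.) -/
theorem quarticSaving_of_squares {η : ℝ} (hη : η ≤ 2) {v w Y Z s t : ℕ} (hv : v = s ^ 2) (hw : w = t ^ 2)
    (hZ : 1 ≤ Z) : QuarticSaving η v w Y Z := by
  intro hv0 hw0 hY _hcop _hmax hne
  have ht : 1 ≤ t := by
    rcases Nat.eq_zero_or_pos t with h0 | h0
    · rw [h0] at hw; simp at hw; omega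
    · exact h0
  have hs : 1 ≤ s := by
    rcases Nat.eq_zero_or_pos s with h0 | h0
    · rw [h0] at hv; simp at hv; omega
    · exact h0
  -- the integer inequality `Z² + 1 ≤ |wZ⁴ − vY⁴|`
  have hfac : ((w : ℤ) * (Z : ℤ) ^ 4 - (v : ℤ) * (Y : ℤ) ^ 4) =
      ((t : ℤ) * (Z : ℤ) ^ 2 - (s : ℤ) * (Y : ℤ) ^ 2) * ((t : ℤ) * (Z : ℤ) ^ 2 + (s : ℤ) * (Y : ℤ) ^ 2) := by
    rw [hv, hw]; push_cast; ring
  have hne' : ((w : ℤ) * (Z : ℤ) ^ 4 - (v : ℤ) * (Y : ℤ) ^ 4) ≠ 0 := by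
    rw [sub_ne_zero]; exact_mod_cast hne
  have hPQ : ((t : ℤ) * (Z : ℤ) ^ 2 - (s : ℤ) * (Y : ℤ) ^ 2) ≠ 0 := by
    intro h; rw [hfac, h, zero_mul] at hne'; exact hne' rfl
  have h1 : (1 : ℤ) ≤ |(t : ℤ) * (Z : ℤ) ^ 2 - (s : ℤ) * (Y : ℤ) ^ 2| := Int.one_le_abs hPQ
  have htZ : ((Z : ℤ)) ^ 2 ≤ (t : ℤ) * (Z : ℤ) ^ 2 := by
    have : (1 : ℤ) ≤ (t : ℤ) := by exact_mod_cast ht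
    nlinarith [sq_nonneg (Z : ℤ)]
  have hsY : (1 : ℤ) ≤ (s : ℤ) * (Y : ℤ) ^ 2 := by
    have h1s : (1 : ℤ) ≤ (s : ℤ) := by exact_mod_cast hs
    have h1Y : (1 : ℤ) ≤ (Y : ℤ) := by exact_mod_cast hY
    nlinarith
  have hint : ((Z : ℤ)) ^ 2 + 1 ≤ |(w : ℤ) * (Z : ℤ) ^ 4 - (v : ℤ) * (Y : ℤ) ^ 4| := by
    rw [hfac, abs_mul]
    have hsum : 0 ≤ (t : ℤ) * (Z : ℤ) ^ 2 + (s : ℤ) * (Y : ℤ) ^ 2 := by positivity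
    calc ((Z : ℤ)) ^ 2 + 1 ≤ (t : ℤ) * (Z : ℤ) ^ 2 + (s : ℤ) * (Y : ℤ) ^ 2 := by linarith
      _ = 1 * |(t : ℤ) * (Z : ℤ) ^ 2 + (s : ℤ) * (Y : ℤ) ^ 2| := by rw [one_mul, abs_of_nonneg hsum]
      _ ≤ |(t : ℤ) * (Z : ℤ) ^ 2 - (s : ℤ) * (Y : ℤ) ^ 2| * |(t : ℤ) * (Z : ℤ) ^ 2 + (s : ℤ) * (Y : ℤ) ^ 2| :=
          mul_le_mul_of_nonneg_right h1 (abs_nonneg _)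
  -- cast to `ℝ` and compare with `Z^η ≤ Z²`
  have hreal : ((Z : ℝ)) ^ 2 + 1 ≤ |((w * Z ^ 4 : ℕ) : ℝ) - ((v * Y ^ 4 : ℕ) : ℝ)| := by
    have h := (Int.cast_le (R := ℝ)).mpr hint
    push_cast at h ⊢
    exact h
  have hZ1 : (1 : ℝ) ≤ (Z : ℝ) := by exact_mod_cast hZ
  have hpow : (Z : ℝ) ^ η ≤ (Z : ℝ) ^ 2 := by
    have h := Real.rpow_le_rpow_of_exponent_le hZ1 hη
    rwa [show ((Z : ℝ)) ^ (2 : ℝ) = (Z : ℝ) ^ 2 by exact_mod_cast Real.rpow_natCast (Z : ℝ) 2] at h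
  linarith

/-! ## The composition (kernel-checked; concludes the crux BY NAME) -/

/-- **`TowerFourSubLiouville_of`** — the glue of the line: the core (Stub 3) gives `η > 0` and a box `H` off which
fourth-power-free forms have the saving; shrink to `η' = min η 1 < 2`; stratum R (Stub 2) gives the saving ON the box;
`ubq_of_on_off` assembles `UBQ η'`; the transfer (Stub 1) turns it into the crux. -/
theorem TowerFourSubLiouville_of (hT : Registered.stub_transfer) (hR : Registered.stub_fixedFormsRoth)
    (hG : Registered.stub_genericFormsSaving) :
    Summit.ABC.ABC.Theses.IneffectiveSubspace.TowerFourSubLiouville := by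
  obtain ⟨η, hη, H, hoff⟩ := hG
  have hη' : 0 < min η 1 := lt_min hη one_pos
  have hη'2 : min η 1 < 2 := lt_of_le_of_lt (min_le_right _ _) one_lt_two
  have hon : UBQOn H (min η 1) := hR H (min η 1) hη' hη'2
  have hoff' : UBQOff H (min η 1) := by
    obtain ⟨Z₀, h⟩ := hoff
    refine ⟨max Z₀ 1, fun v w Y Z hZ hH hvf hwf => ?_⟩
    exact quarticSaving_mono (min_le_left η 1) (le_trans (le_max_right _ _) hZ)
      (h v w Y Z (le_trans (le_max_left _ _) hZ) hH hvf hwf)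
  exact hT ⟨min η 1, hη', ubq_of_on_off hη'.le hon hoff'⟩

/-- Wiring check: the registered stubs feed `TowerFourSubLiouville_of` as stated (definitional unfolding only). -/
example : Summit.ABC.ABC.Theses.IneffectiveSubspace.TowerFourSubLiouville :=
  TowerFourSubLiouville_of stub_transfer stub_fixedFormsRoth stub_genericFormsSaving

end Summit.ABC.ABC.Cruxes.TowerFourSubLiouville.FourthRadicalBinomialThue
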